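import Summits.KontsevichZagierPeriods.KontsevichZagierPeriods.Theses.HurwitzMicroSectors
import Literature.NumberTheory.Transcendental.KZLogCalculusProofs
import Literature.NumberTheory.Transcendental.KZSemialgebraicComplex
import Literature.NumberTheory.Transcendental.EllIterRep
import Summits.KontsevichZagierPeriods.KontsevichZagierPeriods.Theorems.MzvKernelInKZ.Negative.PiLine
import Mathlib.NumberTheory.Niven

/-!
# `HurwitzSectorComplement` (stmt-KontsevichZagierPeriods-14341, route HurwitzMicroSectors),
# line `chebyshev-level-deformation`: stub `stub_arcRotation` (S4), auxiliary file — the moves and the grid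

In the half-angle chart `v = tan φ` every angle integral is an ARC representation `[I, g]`,
`g(v) = 2/(1+v²)`, over an interval `I ⊆ ℝ¹`.  For `0 < 2a < N` put `θ = π/(2N)`,
`t_k = tan(kθ)` (`0 ≤ k ≤ N − 1`; real algebraic, `Real.isAlgebraic_tan_rat_mul_pi`), so that
`t_{2a} = tan(πa/N)`, and let `I_k = (t_k, t_{k+1})` (`k ≤ N − 2`), `I_{N−1} = (t_{N−1}, ∞)` be the
grid arcs.  The Möbius ROTATION `R_k(v) = (v − t_k)/(1 + t_k v)` is a `ℚ`-semialgebraic bijection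
`I_k → I_0 = (0, t_1)` with `R_k' = (1 + t_k²)/(1 + t_k v)² > 0` and `g(R_k v) R_k'(v) = g(v)`
(rule (2); the endpoint identity `R_k(t_{k+1}) = t_1` is the tangent subtraction formula), and the
inversion `v ↦ 1/v` folds `(t_{N−1}, ∞)` onto `(0, 1/t_{N−1}) = (0, t_1)` and `(1, ∞)` onto `(0,1)`.
Cutting at the null points `t_k` (rule (1a)):
`[(0, t_{2a}), g] ≡ 2a • [I_0, g]`, `[(t_{2a}, ∞), g] ≡ (N − 2a) • [I_0, g]`,
`N • [I_0, g] ≡ [(0, ∞), g] ≡ 2 • [(0,1), g]`.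

All moves are the one-dimensional line moves of `Theorems/MzvKernelInKZ/Negative/PiLine.lean`
(`lineRep`, `lineRep_cov`, `line_peel`, `L1i_cov`) for the form `h = dt/(1+t²) = g/2`; the passage
`[I, g] ≡ 2 • [I, h]` is one integrand additivity.

THIS FILE: semialgebraic intervals with algebraic endpoints, `[I, g] ≡ 2 • [I, h]`, the splitting
lemma `line_split`, the two rule-(2) moves `rot_cov` (Möbius rotation) and `inv_cov` (inversion),
`(0, ∞) ≡ 2 • (0, 1)` (`halfline_two`), and the trigonometry of the grid `t_k = tan(kπ/2N)`
(positivity, addition formula, cotangent identity, algebraicity).  The ladder inductions and the stub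
itself are in `…StubArcRotation.lean`.

References: M. Kontsevich, D. Zagier, *Periods* (2001), §1.2 rules (1), (2).
-/

noncomputable section

open Set MeasureTheory MvPolynomial
open scoped BigOperators
open Literature.NumberTheory.Transcendental
open Literature.ModelTheory.ExponentialFields (IsSemialgebraic)

namespace Summit.KontsevichZagierPeriods.Theorems.HurwitzMicroSectorsHurwitzSectorComplement

namespace ArcRotation

open Summit.KontsevichZagierPeriods.MzvKernelInKZ.Negative

/-! ### Semialgebraic intervals with algebraic endpoints; bookkeeping of line representations -/

/-- Open intervals with real-algebraic endpoints are `ℚ`-semialgebraic in `ℝ¹`. [folklore] -/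
theorem sa_Ioo {a b : ℝ} (ha : IsAlgebraic ℚ a) (hb : IsAlgebraic ℚ b) :
    IsSemialgebraic ℚ {x : Fin 1 → ℝ | a < x 0 ∧ x 0 < b} :=
  (KZ.isSemialgebraic_setOf_const_lt_apply ha 0).inter (KZ.isSemialgebraic_setOf_apply_lt_const hb 0)

/-- Open rays with real-algebraic endpoint are `ℚ`-semialgebraic in `ℝ¹`. [folklore] -/
theorem sa_Ioi {a : ℝ} (ha : IsAlgebraic ℚ a) : IsSemialgebraic ℚ {x : Fin 1 → ℝ | a < x 0} :=
  KZ.isSemialgebraic_setOf_const_lt_apply ha 0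

/-- `[I, g] ≡ 2 • [I, h]` for `g = 2/(1+v²) = 2h` (one integrand additivity).
[cite: KontsevichZagier2001, §1.2 rule (1)] -/
theorem of_sub_two_lineRep (g : ℝ → ℝ) (hg : ∀ v, g v = 2 / (1 + v ^ 2)) (r : KZ.IntegralRep 1)
    (hr : EqOn r.integrand (fun y => g (y 0)) r.domain) :
    KZ.of r - 2 • KZ.of (lineRep r.domain r.isSemialgebraic_domain) ∈ KZ.relations := by
  have h := KZ.integrandAddRel_subset_relations ⟨1, r, lineRep r.domain r.isSemialgebraic_domain,
    lineRep r.domain r.isSemialgebraic_domain, rfl, rfl, fun x hx => by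
      simp only [Pi.add_apply, hr hx, hg]
      simp only [lineRep, hq]
      ring, rfl⟩
  simpa [two_nsmul, sub_sub] using h

/-- Two line representations `[S, h]`, `[S', h]` with `S = S'` are congruent. [folklore] -/
theorem lineRep_congr {S S' : Set (Fin 1 → ℝ)} (hS : IsSemialgebraic ℚ S) (hS' : IsSemialgebraic ℚ S')
    (h : S = S') : KZ.of (lineRep S hS) - KZ.of (lineRep S' hS') ∈ KZ.relations :=
  KZ.of_sub_of_mem_relations_of_eqOn h.symm fun _ _ => rfl

/-- Cutting a line representation into two pieces and a null remainder (two domain additivities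
and a null point). [cite: KontsevichZagier2001, §1.2 rule (1)] -/
theorem line_split {T P P₂ : Set (Fin 1 → ℝ)} (hT : IsSemialgebraic ℚ T) (hP : IsSemialgebraic ℚ P)
    (hP₂ : IsSemialgebraic ℚ P₂) (hPT : P ⊆ T) (hP₂T : P₂ ⊆ T \ P) (c : ℝ)
    (hrest : (T \ P) \ P₂ ⊆ {x | x 0 = c}) :
    KZ.of (lineRep T hT) - KZ.of (lineRep P hP) - KZ.of (lineRep P₂ hP₂) ∈ KZ.relations := by
  have d1 := KZ.domainAddRel_subset_relations (line_peel hT hP hPT)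
  have d2 := KZ.domainAddRel_subset_relations (line_peel (hT.diff hP) hP₂ hP₂T)
  have d3 : KZ.of (lineRep ((T \ P) \ P₂) ((hT.diff hP).diff hP₂)) ∈ KZ.relations :=
    KZ.of_mem_relations_of_volume_eq_zero _ (measure_mono_null hrest (volume_pt1 c))
  have e : KZ.of (lineRep T hT) - KZ.of (lineRep P hP) - KZ.of (lineRep P₂ hP₂) =
      (KZ.of (lineRep T hT) - KZ.of (lineRep P hP) - KZ.of (lineRep (T \ P) (hT.diff hP))) +
      (KZ.of (lineRep (T \ P) (hT.diff hP)) - KZ.of (lineRep P₂ hP₂) -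
        KZ.of (lineRep ((T \ P) \ P₂) ((hT.diff hP).diff hP₂))) +
      KZ.of (lineRep ((T \ P) \ P₂) ((hT.diff hP).diff hP₂)) := by abel
  rw [e]
  exact add_mem (add_mem d1 d2) d3

/-! ### The two rule-(2) moves: a Möbius rotation and the inversion -/

/-- **The Möbius rotation move.** For real algebraic `t ≥ 0`, `s > 0` with `ts < 1` and
`u (1 − ts) = t + s` (i.e. `u = tan(x+y)` for `t = tan x`, `s = tan y`), the map
`v ↦ (v − t)/(1 + tv)` is a `ℚ`-semialgebraic bijection `(t, u) → (0, s)` with derivative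
`(1+t²)/(1+tv)² > 0` preserving `dv/(1+v²)`: `[(t,u), h] − [(0,s), h]` is a change of variables.
[cite: KontsevichZagier2001, §1.2 rule (2)] -/
theorem rot_cov {t s u : ℝ} (ht : 0 ≤ t) (hs : 0 < s) (hts : t * s < 1) (hu : u * (1 - t * s) = t + s)
    (hta : IsAlgebraic ℚ t) (hsa : IsAlgebraic ℚ s) (hua : IsAlgebraic ℚ u) :
    KZ.of (lineRep {x : Fin 1 → ℝ | t < x 0 ∧ x 0 < u} (sa_Ioo hta hua)) -
      KZ.of (lineRep {x : Fin 1 → ℝ | 0 < x 0 ∧ x 0 < s} (sa_Ioo isAlgebraic_zero hsa)) ∈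
      KZ.changeOfVariablesRel := by
  have hts' : 0 < 1 - t * s := by linarith
  have hu_pos : 0 < u := pos_of_mul_pos_left (by rw [hu]; linarith) hts'.le
  -- denominators are positive on the source interval
  have hden : ∀ x ∈ {x : Fin 1 → ℝ | t < x 0 ∧ x 0 < u}, 0 < 1 + t * x 0 := fun x hx => by
    have : 0 ≤ t * x 0 := mul_nonneg ht (ht.trans hx.1.le)
    linarith
  refine lineRep_cov (sa_Ioo hta hua) (sa_Ioo isAlgebraic_zero hsa)
    (fun v => (v - t) / (1 + t * v)) (fun v => (1 + t ^ 2) / (1 + t * v) ^ 2) ?_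
    (fun x hx => ?_) ?_ ?_ (fun x hx => ?_)
  · -- semialgebraicity (the coefficient `t` is a real algebraic constant)
    have hS := sa_Ioo (a := t) (b := u) hta hua
    have hx : IsSemialgebraicFunOn ℚ {x : Fin 1 → ℝ | t < x 0 ∧ x 0 < u} fun x => x 0 :=
      (isSemialgebraicFunOn_aeval hS (X 0)).congr fun x _ => by simp
    have hc : IsSemialgebraicFunOn ℚ {x : Fin 1 → ℝ | t < x 0 ∧ x 0 < u} fun _ => t :=
      isSemialgebraicFunOn_const_of_isAlgebraic hS hta
    have h1 : IsSemialgebraicFunOn ℚ {x : Fin 1 → ℝ | t < x 0 ∧ x 0 < u} fun _ => (1 : ℝ) :=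
      (isSemialgebraicFunOn_aeval hS 1).congr fun x _ => by simp
    exact (IsSemialgebraicFunOn.div (IsSemialgebraicFunOn.sub_holds hx hc)
      (IsSemialgebraicFunOn.add_holds h1 (IsSemialgebraicFunOn.mul_holds hc hx))
      fun x hx => (hden x hx).ne').congr fun x _ => by simp
  · -- derivative
    have h0 := hden x hx
    have hd : HasDerivAt (fun v => (v - t) / (1 + t * v))
        ((1 * (1 + t * x 0) - (x 0 - t) * (t * 1)) / (1 + t * x 0) ^ 2) (x 0) :=
      ((hasDerivAt_id' (x 0)).sub_const t).div (((hasDerivAt_id' (x 0)).const_mul t).const_add 1)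
        h0.ne'
    convert hd using 1
    field_simp
    ring
  · -- injectivity
    intro x hx y hy h
    have hx0 := hden x hx
    have hy0 := hden y hy
    have h' : (x 0 - t) / (1 + t * x 0) = (y 0 - t) / (1 + t * y 0) := congrFun h 0
    rw [div_eq_div_iff hx0.ne' hy0.ne'] at h'
    have h2 : (x 0 - y 0) * (1 + t ^ 2) = 0 := by linear_combination h'
    rcases mul_eq_zero.mp h2 with h3 | h3
    · funext i; fin_cases i; simpa [sub_eq_zero] using h3
    · exact absurd h3 (one_add_sq_ne t)
  · -- image
    apply Subset.antisymm
    · rintro _ ⟨x, hx, rfl⟩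
      have h0 := hden x hx
      obtain ⟨h1, h2⟩ := hx
      refine ⟨?_, ?_⟩
      · show 0 < (x 0 - t) / (1 + t * x 0)
        exact div_pos (by linarith) h0
      · show (x 0 - t) / (1 + t * x 0) < s
        rw [div_lt_iff₀ h0]
        nlinarith [mul_pos (sub_pos.2 h2) hts']
    · rintro y ⟨h1, h2⟩
      have htw : 0 < 1 - t * y 0 := by nlinarith [mul_le_mul_of_nonneg_left h2.le ht]
      refine ⟨fun _ => (y 0 + t) / (1 - t * y 0), ⟨?_, ?_⟩, ?_⟩
      · show t < (y 0 + t) / (1 - t * y 0)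
        rw [lt_div_iff₀ htw]
        nlinarith [sq_nonneg t, mul_pos h1 (one_add_sq_pos t)]
      · show (y 0 + t) / (1 - t * y 0) < u
        rw [div_lt_iff₀ htw]
        nlinarith [mul_pos (sub_pos.2 h2) (show 0 < 1 + u * t by positivity)]
      · funext i
        fin_cases i
        show ((y 0 + t) / (1 - t * y 0) - t) / (1 + t * ((y 0 + t) / (1 - t * y 0))) = y 0
        have hne : 1 - t * y 0 ≠ 0 := htw.ne'
        have hd' : 1 + t * ((y 0 + t) / (1 - t * y 0)) = (1 + t ^ 2) / (1 - t * y 0) := by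
          rw [eq_div_iff hne, add_mul, mul_assoc, div_mul_cancel₀ _ hne]
          ring
        have hn' : (y 0 + t) / (1 - t * y 0) - t = y 0 * (1 + t ^ 2) / (1 - t * y 0) := by
          rw [eq_div_iff hne, sub_mul, div_mul_cancel₀ _ hne]
          ring
        rw [hd', hn', div_div_div_cancel_right₀ hne, mul_div_cancel_right₀ _ (one_add_sq_ne t)]
  · -- the form `dv/(1+v²)` is invariant
    have h0 : 1 + t * x 0 ≠ 0 := (hden x hx).ne'
    have h0' : 0 < 1 + t * x 0 := hden x hx
    rw [abs_of_pos (by positivity)]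
    have key : 1 + ((x 0 - t) / (1 + t * x 0)) ^ 2 = (1 + t ^ 2) * (1 + x 0 ^ 2) / (1 + t * x 0) ^ 2 := by
      rw [eq_div_iff (pow_ne_zero 2 h0), add_mul, div_pow, div_mul_cancel₀ _ (pow_ne_zero 2 h0)]
      ring
    simp only [hq]
    rw [key, one_div_div, div_mul_div_comm, div_eq_div_iff (one_add_sq_ne _)
      (mul_ne_zero (mul_ne_zero (one_add_sq_ne t) (one_add_sq_ne (x 0))) (pow_ne_zero 2 h0))]
    ring

/-- **The inversion move.** For real algebraic `c > 0`, `v ↦ 1/v` is a `ℚ`-semialgebraic bijection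
`(c, ∞) → (0, 1/c)` preserving `dv/(1+v²)`: `[(c,∞), h] − [(0,1/c), h]` is a change of variables.
[cite: KontsevichZagier2001, §1.2 rule (2)] -/
theorem inv_cov {c : ℝ} (hc : 0 < c) (hca : IsAlgebraic ℚ c) :
    KZ.of (lineRep {x : Fin 1 → ℝ | c < x 0} (sa_Ioi hca)) -
      KZ.of (lineRep {x : Fin 1 → ℝ | 0 < x 0 ∧ x 0 < c⁻¹} (sa_Ioo isAlgebraic_zero hca.inv)) ∈
      KZ.changeOfVariablesRel := by
  refine lineRep_cov (sa_Ioi hca) (sa_Ioo isAlgebraic_zero hca.inv) (fun v => v⁻¹)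
    (fun v => -(v ^ 2)⁻¹) ?_ (fun x hx => ?_) ?_ ?_ (fun x hx => ?_)
  · refine (isSemialgebraicFunOn_aeval_div_aeval (sa_Ioi hca) (1 : MvPolynomial (Fin 1) ℚ) (X 0)
      fun x hx => ?_).congr fun x _ => by simp
    have : c < x 0 := hx
    simp only [aeval_X]
    linarith
  · have : c < x 0 := hx
    exact hasDerivAt_inv (by linarith)
  · intro x _ y _ h
    have : (x 0)⁻¹ = (y 0)⁻¹ := congrFun h 0
    funext i; fin_cases i; simpa using inv_inj.mp this
  · apply Subset.antisymm
    · rintro _ ⟨x, hx, rfl⟩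
      have : c < x 0 := hx
      exact ⟨by simp; linarith, by simpa using inv_strictAnti₀ hc this⟩
    · intro y hy
      obtain ⟨h0, h1⟩ := hy
      refine ⟨fun _ => (y 0)⁻¹, ?_, ?_⟩
      · show c < (y 0)⁻¹
        rwa [lt_inv_comm₀ hc h0]
      · funext i; fin_cases i; simp
  · have : c < x 0 := hx
    have hx0 : x 0 ≠ 0 := by linarith
    rw [abs_of_neg (by simp; positivity)]
    simp only [hq]
    field_simp
    ring

/-- `(0, ∞) ≡ 2 • (0, 1)` for the form `h`: cut at the null point `1` and fold `(1, ∞)` onto `(0, 1)`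
by `v ↦ 1/v` (`L1i_cov`). [cite: KontsevichZagier2001, §1.2 rules (1), (2)] -/
theorem halfline_two :
    KZ.of (lineRep {x : Fin 1 → ℝ | 0 < x 0} (sa_Ioi isAlgebraic_zero)) -
      2 • KZ.of (lineRep L01 sa_L01) ∈ KZ.relations := by
  have hsplit := line_split (sa_Ioi isAlgebraic_zero) sa_L01 sa_L1i
    (fun x hx => hx.1)
    (fun x hx => ⟨lt_trans one_pos (show (1 : ℝ) < x 0 from hx),
      fun h => lt_irrefl _ (h.2.trans (show (1 : ℝ) < x 0 from hx))⟩)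
    1 (fun x hx => le_antisymm (not_lt.mp hx.2) (not_lt.mp fun h => hx.1.2 ⟨hx.1.1, h⟩))
  have hcov := KZ.changeOfVariablesRel_subset_relations L1i_cov
  have e : KZ.of (lineRep {x : Fin 1 → ℝ | 0 < x 0} (sa_Ioi isAlgebraic_zero)) -
      2 • KZ.of (lineRep L01 sa_L01) =
      (KZ.of (lineRep {x : Fin 1 → ℝ | 0 < x 0} (sa_Ioi isAlgebraic_zero)) - KZ.of (lineRep L01 sa_L01) -
        KZ.of (lineRep L1i sa_L1i)) + (KZ.of (lineRep L1i sa_L1i) - KZ.of (lineRep L01 sa_L01)) := by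
    abel
  rw [e]
  exact add_mem hsplit hcov

/-! ### The cyclotomic grid `t_k = tan(kπ/2N)` -/

section Grid

open Real

/-- `kπ/(2N) < π/2` for `k < N`. [folklore] -/
theorem grid_angle_lt {N k : ℕ} (hk : k < N) : (k : ℝ) * (π / (2 * N)) < π / 2 := by
  have hN : (0 : ℝ) < N := by exact_mod_cast (Nat.zero_le k).trans_lt hk
  have h1 : (k : ℝ) / N < 1 := (div_lt_one hN).mpr (by exact_mod_cast hk)
  have e : (k : ℝ) * (π / (2 * N)) = (k / N) * (π / 2) := by ring
  rw [e]
  calc (k : ℝ) / N * (π / 2) < 1 * (π / 2) := mul_lt_mul_of_pos_right h1 (by positivity)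
    _ = π / 2 := one_mul _

/-- `0 ≤ kπ/(2N)`. [folklore] -/
theorem grid_angle_nonneg (N k : ℕ) : 0 ≤ (k : ℝ) * (π / (2 * N)) := by positivity

/-- `t_k ≥ 0` for `k < N`. [folklore] -/
theorem grid_nonneg {N k : ℕ} (hk : k < N) : 0 ≤ tan ((k : ℝ) * (π / (2 * N))) :=
  tan_nonneg_of_nonneg_of_le_pi_div_two (grid_angle_nonneg N k) (grid_angle_lt hk).le

/-- `t_k > 0` for `0 < k < N`. [folklore] -/
theorem grid_pos {N k : ℕ} (h0 : 0 < k) (hk : k < N) : 0 < tan ((k : ℝ) * (π / (2 * N))) := by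
  have hN : (0 : ℝ) < N := by exact_mod_cast h0.trans hk
  refine tan_pos_of_pos_of_lt_pi_div_two (mul_pos (by exact_mod_cast h0) ?_) (grid_angle_lt hk)
  positivity

/-- `cos(kπ/2N) > 0` for `k < N`. [folklore] -/
theorem grid_cos_pos {N k : ℕ} (hk : k < N) : 0 < cos ((k : ℝ) * (π / (2 * N))) :=
  cos_pos_of_mem_Ioo ⟨by linarith [grid_angle_nonneg N k, pi_pos], grid_angle_lt hk⟩

/-- The tangent addition formula in the first quadrant: for `cos x, cos y, cos (x+y) > 0`,
`tan x tan y < 1` and `tan(x+y) (1 − tan x tan y) = tan x + tan y`. [folklore] -/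
theorem tan_add_of_cos_pos {x y : ℝ} (hx : 0 < cos x) (hy : 0 < cos y) (hxy : 0 < cos (x + y)) :
    tan x * tan y < 1 ∧ tan (x + y) * (1 - tan x * tan y) = tan x + tan y := by
  have hc : cos x * cos y ≠ 0 := mul_ne_zero hx.ne' hy.ne'
  have e : 1 - tan x * tan y = cos (x + y) / (cos x * cos y) := by
    rw [eq_div_iff hc, cos_add, tan_eq_sin_div_cos, tan_eq_sin_div_cos, sub_mul, div_mul_div_comm,
      div_mul_cancel₀ _ hc, one_mul]
  refine ⟨?_, ?_⟩
  · have : 0 < 1 - tan x * tan y := by rw [e]; exact div_pos hxy (mul_pos hx hy)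
    linarith
  · rw [e]
    simp only [tan_eq_sin_div_cos]
    rw [sin_add, div_mul_div_comm, div_add_div _ _ hx.ne' hy.ne',
      div_eq_div_iff (mul_ne_zero hxy.ne' hc) hc]
    ring

/-- Grid step (`k + 1 < N`): `t_k t_1 < 1` and `t_{k+1} (1 − t_k t_1) = t_k + t_1`. [folklore] -/
theorem grid_add {N k : ℕ} (hk : k + 1 < N) :
    tan ((k : ℝ) * (π / (2 * N))) * tan (((1 : ℕ) : ℝ) * (π / (2 * N))) < 1 ∧
      tan (((k + 1 : ℕ) : ℝ) * (π / (2 * N))) *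
          (1 - tan ((k : ℝ) * (π / (2 * N))) * tan (((1 : ℕ) : ℝ) * (π / (2 * N)))) =
        tan ((k : ℝ) * (π / (2 * N))) + tan (((1 : ℕ) : ℝ) * (π / (2 * N))) := by
  have e : ((k + 1 : ℕ) : ℝ) * (π / (2 * N)) =
      (k : ℝ) * (π / (2 * N)) + ((1 : ℕ) : ℝ) * (π / (2 * N)) := by
    push_cast; ring
  rw [e]
  refine tan_add_of_cos_pos (grid_cos_pos (by omega)) (grid_cos_pos (by omega)) ?_
  rw [← e]; exact grid_cos_pos hk

/-- The cotangent identity on the grid (`N ≥ 2`): `t_{N−1} t_1 = 1` (`tan(π/2 − θ) = 1/tan θ`).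
[folklore] -/
theorem grid_cot {N : ℕ} (hN : 2 ≤ N) :
    tan (((N - 1 : ℕ) : ℝ) * (π / (2 * N))) * tan (((1 : ℕ) : ℝ) * (π / (2 * N))) = 1 := by
  have hN0 : (N : ℝ) ≠ 0 := by exact_mod_cast (show N ≠ 0 by omega)
  have e1 : (N : ℝ) * (π / (2 * N)) = π / 2 := by
    rw [← mul_div_assoc, mul_comm (N : ℝ) π, mul_div_mul_right _ _ hN0]
  have e : ((N - 1 : ℕ) : ℝ) * (π / (2 * N)) = π / 2 - ((1 : ℕ) : ℝ) * (π / (2 * N)) := by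
    rw [Nat.cast_sub (by omega : 1 ≤ N), Nat.cast_one, sub_mul, e1, one_mul]
  rw [e, tan_pi_div_two_sub]
  exact inv_mul_cancel₀ (grid_pos one_pos (by omega)).ne'

/-- The grid is real algebraic: `tan(qπ)` is algebraic for rational `q`
(Mathlib `Real.isAlgebraic_tan_rat_mul_pi`). [folklore] -/
theorem grid_isAlgebraic (N k : ℕ) : IsAlgebraic ℚ (tan ((k : ℝ) * (π / (2 * N)))) := by
  have h := (Real.isAlgebraic_tan_rat_mul_pi ((k : ℚ) / (2 * N))).extendScalars
    (R := ℤ) (S := ℚ) (A := ℝ) (RingHom.injective_int (algebraMap ℤ ℚ))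
  convert h using 2
  push_cast
  ring

end Grid

end ArcRotation

/-- **Registered auxiliary sub-goal of `stub_arcRotation` (tangent addition in the first quadrant).**
For `cos x, cos y, cos (x+y) > 0`: `tan x · tan y < 1` and `tan(x+y) (1 − tan x tan y) = tan x + tan y` —
the endpoint identity `R_k(t_{k+1}) = t_1` of the Möbius rotations between consecutive grid arcs
(`ArcRotation.tan_add_of_cos_pos`, `ArcRotation.grid_add`). [folklore] -/
theorem arcRotation_tanAdd : ∀ (x y : ℝ), 0 < Real.cos x → 0 < Real.cos y → 0 < Real.cos (x + y) → Real.tan x * Real.tan y < 1 ∧ Real.tan (x + y) * (1 - Real.tan x * Real.tan y) = Real.tan x + Real.tan y :=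
  fun _ _ hx hy hxy => ArcRotation.tan_add_of_cos_pos hx hy hxy

end Summit.KontsevichZagierPeriods.Theorems.HurwitzMicroSectorsHurwitzSectorComplement

end
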